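import Summits.QuantumFields.YangMills.Theorems.BalabanUVNodesN18CombStepBaseChange
import HarnessLib

/-!
# N18 (β)-transport letters: THE C⁰ CANCELLED SUM `|A′_A − i∇^ξ_{U_A} l|` AT ONE COARSE BOND WITH THE SITE-WISE COMB GENERATOR

[DAGN18W3-G5 INTENT-2, file (2b)] — count-neutral helper toward K3⁸ `stmt-QuantumFields-27366` (K3⁷ `stmt-QuantumFields-20544` aside; NOT claimed, NOT closed).
YM mass gap (Clay) NOT proved by any of this; R4 closes the conditional finite-𝕋⁴ rung `BalabanLadder.UV` only.

WHY ∕ WHAT.  With `m(y) := λ̄_{Ad(axialT U (emb y))A′}(y)` — the comb mean of `A′` read in the axial gauge of the block of `y` based at its own centre — the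
comb generator of FILE 7's `hrest` (G p619718) is `l = iη·m` (ONE object per coarse site), and at a coarse bond `c`
`A′_A(c) − i∇^ξ_{U_A} l(c) = (iξ)⁻¹ log(Ū(𝐔)(c)U_A(c)⁻¹) + (η∕ξ)·(U_A(c)·m(c₊)·U_A(c)⁻¹ − m(c₋))`, `U_A(c) = Ū(U)(c)`.  This file bounds it:
★★ `norm_potential_add_transported_comb_le`: `≤ (η∕ξ)·L·a + R∕ξ + (η∕ξ)·69ℓ²·t·a` under INTENT-1's two-block-local hypotheses — INTENT-1 ★★ (the letter in the
source gauge `v₀ = axialT U (emb c₋)`, `λ̄_{v₀}(c₋) = m(c₋)` verbatim) + (2a) ★ (base change of the comb means, `ℓ²ta`) + `U_A(c) = Ū(U^{v₀})(c)·g`,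
`g = v₀(emb c₊)`, `‖Ū(U^{v₀})(c) − 1‖ ≤ 17ℓt` (UST Prop. 3 at the flat background, two-block local, on the factor cut off to `1` off the two blocks) +
`‖EYE⁻¹ − Y‖ ≤ 4·17ℓt·‖Y‖`, `‖m(c₊)‖ ≤ ℓa`.  Leading coefficient `ηL∕ξ = 1` on the `α₁`-radius; everything else second order.
What is NOT here (successor): the record-level `hrest` tuple (tracelessness via the frame cut-off of `A′`, `δ₀ = (d+2)a`, crude `δ₁`, `s₁`), the C¹ letter.

0 `def`, 0 `sorry`.  References: T. Bałaban, CMP **98** (1985) 17–51 [Balaban1985Averaging] ((8)–(11) pp.18–19, pp.24–25, (62)–(63) p.28, (122)–(126) p.36);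
CMP **109** (1987) [Balaban1987RG1] ((0.4) p.253, (1.10)–(1.13) p.262).
-/

noncomputable section

open scoped BigOperators Matrix.Norms.L2Operator
open NormedSpace

namespace YMDAG.N18.TransportOfRecord

open Complex (I)
open Literature.MathematicalPhysics.QuantumFieldTheory.Balaban1983to89
open Literature.MathematicalPhysics.QuantumFieldTheory.Balaban1983to89.T4Continuum
open Literature.MathematicalPhysics.QuantumFieldTheory.Balaban1983to89.BlockAveraging
open Literature.MathematicalPhysics.QuantumFieldTheory.Balaban1983to89.BlockAveragingEMLLinearised (combMean)
open Literature.MathematicalPhysics.QuantumFieldTheory.Balaban1983to89.B12RegularSpaces111 (expI gaugeU adJ plaq plaq_eq)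
open Literature.MathematicalPhysics.QuantumFieldTheory.Balaban1983to89.MatrixLog (mlog)
open Literature.MathematicalPhysics.QuantumFieldTheory.Balaban1983to89.B7Prop1Explicit (U1 mem_U1)
open Literature.MathematicalPhysics.QuantumFieldTheory.Balaban1983to89.B10Eq27TorusAxialLog (axialT axialT_self)
open Literature.MathematicalPhysics.QuantumFieldTheory.Balaban1983to89.T4TermwiseBCH (norm_units_conj_le)
open Literature.MathematicalPhysics.QuantumFieldTheory.Balaban1983to89.Node00.W1 (avgUnits)
open Summit.QuantumFields.YangMills.Theorems.Prop8Chart (emlAvgU_congr₂ norm_emlAvgU_sub_one_sub_linAvg_le)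
open YMDAG.N18.AvgPotential (combMean_congr_block)

variable {P : Params} {j : ℕ}

section C0Sum

variable {n : Type*} [Fintype n] [DecidableEq n] [Nonempty n]

/-- ★★ **THE C⁰ CANCELLED SUM AT ONE COARSE BOND WITH THE SITE-WISE COMB.**  Let `m(y) := λ̄_{Ad(axialT U (emb y))A′}(y)` (the comb mean of `A′` in the axial
gauge of the block of `y` based at its centre) and `U_A(c) := Ū(U)(c)`.  Under INTENT-1's two-block-local hypotheses at `c` (factorisation `𝐔 = (exp iηA′)·U`,
`|A′| ≤ a`, `U ∈ U1`, plaquettes `≤ α`, `((d+2)L∕2)α ≤ t`, `ηa ≤ 1∕2`, `136ℓ((2ηa + t + 2ηa·t) + t) ≤ 1`):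
`‖(iξ)⁻¹ log(Ū(𝐔)(c)·U_A(c)⁻¹) + (η∕ξ)·(U_A(c)·m(c₊)·U_A(c)⁻¹ − m(c₋))‖ ≤ (η∕ξ)·L·a + R∕ξ + (η∕ξ)·69ℓ²·t·a` — and the left side IS
`A′_A(c) − i∇^ξ_{U_A} l(c)` for the comb generator `l = iη·m` (`i·(iη) = −η`; successor file reads it in FILE 7's letters).  INTENT-1 ★★ + ★ (base change of the
comb means) + `U_A(c) = Ū(U^{v₀})(c)·g`, `‖Ū(U^{v₀})(c) − 1‖ ≤ 17ℓt` (UST Prop. 3, flat background, two-block local) + `‖EYE⁻¹ − Y‖ ≤ 4·17ℓt·‖Y‖`, `‖m(c₊)‖ ≤ ℓa`.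
[cite: Balaban1985Averaging, (8)-(11) pp.18-19, pp.24-25, Prop. 3 (62)-(63) p.28, (122)-(126) p.36; Balaban1987RG1, (0.4) p.253, (1.10)-(1.13) p.262] -/
theorem norm_potential_add_transported_comb_le (hj : j + 1 ≤ P.m + P.K) (hj2 : j + 2 ≤ P.m + P.K) (c : PBond P (j + 1))
    {Uc U : GaugeField P j (Matrix n n ℂ)ˣ} {A : PBond P j → Matrix n n ℂ} {η ξ a α t : ℝ} (hη : 0 ≤ η) (hξ : 0 < ξ) (ha0 : 0 ≤ a) (hα : 0 ≤ α)
    (hf : ∀ b : PBond P j, (blockOf b.src = c.src ∨ blockOf b.src = c.tgt) → (blockOf b.tgt = c.src ∨ blockOf b.tgt = c.tgt) →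
      Uc b = expI η (A b) * U b)
    (hA : ∀ b : PBond P j, (blockOf b.src = c.src ∨ blockOf b.src = c.tgt) → (blockOf b.tgt = c.src ∨ blockOf b.tgt = c.tgt) → ‖A b‖ ≤ a)
    (hηa : η * a ≤ 1 / 2)
    (hU1 : ∀ b : PBond P j, (blockOf b.src = c.src ∨ blockOf b.src = c.tgt) → (blockOf b.tgt = c.src ∨ blockOf b.tgt = c.tgt) →
      U b ∈ U1 (Matrix n n ℂ))
    (hplaq : ∀ p : Plaq P j, (blockOf p.src = c.src ∨ blockOf p.src = c.tgt) →
      (blockOf (p.src.shift p.μ) = c.src ∨ blockOf (p.src.shift p.μ) = c.tgt) →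
      (blockOf (p.src.shift p.ν) = c.src ∨ blockOf (p.src.shift p.ν) = c.tgt) →
      (blockOf ((p.src.shift p.μ).shift p.ν) = c.src ∨ blockOf ((p.src.shift p.μ).shift p.ν) = c.tgt) →
      ‖((plaq U p : (Matrix n n ℂ)ˣ) : Matrix n n ℂ) - 1‖ ≤ α)
    (hRt : ((((P.d + 2) * P.L : ℕ) : ℝ) / 2) * α ≤ t)
    (hℓ : 136 * (((P.d + 2) * P.L : ℕ) : ℝ) * ((2 * (η * a) + t + 2 * (η * a) * t) + t) ≤ 1) :
    ‖(I * (ξ : ℂ))⁻¹ • mlog (((avgUnits Uc c : (Matrix n n ℂ)ˣ) : Matrix n n ℂ) * (((avgUnits U c)⁻¹ : (Matrix n n ℂ)ˣ) : Matrix n n ℂ)) +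
        ((η / ξ : ℝ) : ℂ) • (((avgUnits U c : (Matrix n n ℂ)ˣ) : Matrix n n ℂ) * combMean (adJ (axialT U (emb c.tgt)) A) c.tgt *
            (((avgUnits U c)⁻¹ : (Matrix n n ℂ)ˣ) : Matrix n n ℂ) - combMean (adJ (axialT U (emb c.src)) A) c.src)‖ ≤
      η / ξ * ((P.L : ℝ) * a) +
      (4 * (34 * (((P.d + 2) * P.L : ℕ) : ℝ) * ((2 * (η * a) + t + 2 * (η * a) * t) + t)) ^ 2 +
        578 * (((P.d + 2) * P.L : ℕ) : ℝ) ^ 2 * ((2 * (η * a) + t + 2 * (η * a) * t) + t) * t +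
        660 * (((P.d + 2) * P.L : ℕ) : ℝ) ^ 2 * ((2 * (η * a) + t + 2 * (η * a) * t) ^ 2 + t ^ 2) +
        3 * (((P.d + 2) * P.L : ℕ) : ℝ) * (2 * (η * a) * t) + 3 * (((P.d + 2) * P.L : ℕ) : ℝ) * (η * a) ^ 2) / ξ +
      η / ξ * (69 * (((P.d + 2) * P.L : ℕ) : ℝ) ^ 2 * t * a) := by
  classical
  have ht0 : 0 ≤ t := le_trans (by positivity) hRt
  set ℓ : ℝ := (((P.d + 2) * P.L : ℕ) : ℝ) with hℓdef
  have hℓ0 : 0 ≤ ℓ := Nat.cast_nonneg _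
  have hℓ1 : 1 ≤ ℓ := by
    rw [hℓdef]; have := P.L_pos; have : 1 ≤ (P.d + 2) * P.L := Nat.one_le_iff_ne_zero.mpr (by positivity); exact_mod_cast this
  have hℓt : 136 * ℓ * t ≤ 1 := by nlinarith [mul_nonneg hη ha0, mul_nonneg (mul_nonneg hη ha0) ht0]
  -- INTENT-1 ★★ and ★ (base change)
  have h1 := norm_potential_add_combGrad_le_axial hj hj2 c hη hξ ha0 hα hf hA hηa hU1 hplaq hRt hℓ
  have h2 := norm_combMean_sub_conj_combMean_le hj hj2 c ha0 hα (fun b h1 h2 => hA b (Or.inr h1) (Or.inr h2)) hU1 hplaq hRt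
  -- names
  set X : Matrix n n ℂ := ((avgUnits Uc c : (Matrix n n ℂ)ˣ) : Matrix n n ℂ) * (((avgUnits U c)⁻¹ : (Matrix n n ℂ)ˣ) : Matrix n n ℂ) with hX
  set v₀ : Site P j → (Matrix n n ℂ)ˣ := axialT U (emb c.src) with hv₀
  set g : (Matrix n n ℂ)ˣ := v₀ (emb c.tgt) with hg
  set mt : Matrix n n ℂ := combMean (adJ (axialT U (emb c.tgt)) A) c.tgt with hmt
  set lt : Matrix n n ℂ := combMean (adJ v₀ A) c.tgt with hlt
  set ls : Matrix n n ℂ := combMean (adJ v₀ A) c.src with hls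
  set UA : (Matrix n n ℂ)ˣ := avgUnits U c with hUA
  -- `U_A(c) = Ū(U^{v₀})(c)·g` with `Ū(U^{v₀})(c)` within `17ℓt` of `1`: on the cut-off field
  let χ : PBond P j → Prop := fun b => (blockOf b.src = c.src ∨ blockOf b.src = c.tgt) ∧ (blockOf b.tgt = c.src ∨ blockOf b.tgt = c.tgt)
  let U' : GaugeField P j (Matrix n n ℂ)ˣ := fun b => if χ b then U b else 1
  have hU'U : ∀ b : PBond P j, (blockOf b.src = c.src ∨ blockOf b.src = c.tgt) → (blockOf b.tgt = c.src ∨ blockOf b.tgt = c.tgt) → U' b = U b :=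
    fun b h1 h2 => by simp only [U', χ, if_pos (And.intro h1 h2)]
  have hU'1 : ∀ b, U' b ∈ U1 (Matrix n n ℂ) := fun b => by
    by_cases hb : χ b
    · simp only [U', if_pos hb]; exact hU1 b hb.1 hb.2
    · simp only [U', if_neg hb]; exact (U1 _).one_mem
  have hplaq' : ∀ p : Plaq P j, (blockOf p.src = c.src ∨ blockOf p.src = c.tgt) →
      (blockOf (p.src.shift p.μ) = c.src ∨ blockOf (p.src.shift p.μ) = c.tgt) →
      (blockOf (p.src.shift p.ν) = c.src ∨ blockOf (p.src.shift p.ν) = c.tgt) →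
      (blockOf ((p.src.shift p.μ).shift p.ν) = c.src ∨ blockOf ((p.src.shift p.μ).shift p.ν) = c.tgt) →
      ‖((plaq U' p : (Matrix n n ℂ)ˣ) : Matrix n n ℂ) - 1‖ ≤ α := fun p c1 c2 c3 c4 => by
    have hpe : plaq U' p = plaq U p := by
      rw [plaq_eq, plaq_eq, hU'U ⟨p.src, p.μ⟩ c1 c2, hU'U ⟨p.src.shift p.μ, p.ν⟩ c2 c4, hU'U ⟨p.src, p.ν⟩ c1 c3,
        hU'U ⟨p.src.shift p.ν, p.μ⟩ c3 (by rw [PBond.tgt, Site.shift_comm]; exact c4)]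
    rw [hpe]; exact hplaq p c1 c2 c3 c4
  set v₀' : Site P j → (Matrix n n ℂ)ˣ := axialT U' (emb c.src) with hv₀'
  have hvv' : ∀ x : Site P j, (blockOf x = c.src ∨ blockOf x = c.tgt) → v₀ x = v₀' x := fun x hx =>
    (axialT_congr_of_twoBlock hj hj2 c hU'U hx).symm
  have hV₀ : ∀ b : PBond P j, (blockOf b.src = c.src ∨ blockOf b.src = c.tgt) → (blockOf b.tgt = c.src ∨ blockOf b.tgt = c.tgt) →
      ‖((gaugeU v₀' U' b : (Matrix n n ℂ)ˣ) : Matrix n n ℂ) - 1‖ ≤ t := fun b h1 h2 =>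
    (norm_gaugeU_axialT_sub_one_le_of_twoBlock hj hj2 hU'1 c hα hplaq' b h1 h2).trans hRt
  have h17 := (norm_emlAvgU_sub_one_sub_linAvg_le hj (S := gaugeU v₀' U') c ht0 (by nlinarith) hV₀).2
  set E : (Matrix n n ℂ)ˣ := avgUnits (gaugeU v₀' U') c with hE
  change ‖(E : Matrix n n ℂ) - 1‖ ≤ 17 * ℓ * t at h17
  have hUA_eq : UA = E * g := by
    have hcov := avgUnits_gaugeU v₀' U'
    have hloc : avgUnits U' c = avgUnits U c := emlAvgU_congr₂ hj c hU'U
    have hE' : E = v₀' (emb c.src) * avgUnits U c * (v₀' (emb c.tgt))⁻¹ := by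
      rw [hE, hcov]; simp only [gaugeU, hloc]
    rw [hE', hv₀', axialT_self, one_mul, hUA, hg, hvv' _ (Or.inr (Site.blockOf_emb hj c.tgt)), hv₀', inv_mul_cancel_right]
  -- assemble: the left side = INTENT-1's combination + (η/ξ)·(base change)
  have hsplit : (I * (ξ : ℂ))⁻¹ • mlog X + ((η / ξ : ℝ) : ℂ) • ((UA : Matrix n n ℂ) * mt * ((UA⁻¹ : (Matrix n n ℂ)ˣ) : Matrix n n ℂ) - ls) =
      ((I * (ξ : ℂ))⁻¹ • mlog X + ((η / ξ : ℝ) : ℂ) • (lt - ls)) +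
        ((η / ξ : ℝ) : ℂ) • (((UA : Matrix n n ℂ) * mt * ((UA⁻¹ : (Matrix n n ℂ)ˣ) : Matrix n n ℂ) -
            (g : Matrix n n ℂ) * mt * ((g⁻¹ : (Matrix n n ℂ)ˣ) : Matrix n n ℂ)) -
          (lt - (g : Matrix n n ℂ) * mt * ((g⁻¹ : (Matrix n n ℂ)ˣ) : Matrix n n ℂ))) := by
    simp only [smul_sub]; abel
  rw [hsplit]
  have hηξ : 0 ≤ η / ξ := div_nonneg hη hξ.le
  -- the base-change block
  have hmt : ‖mt‖ ≤ ℓ * a := by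
    -- `λ̄` at `c₊` reads only `B(c₊)`; there `Ad(u₊)A` is bounded by `a`
    let Y : PBond P j → Matrix n n ℂ := fun b => if blockOf b.src = c.tgt ∧ blockOf b.tgt = c.tgt then adJ (axialT U (emb c.tgt)) A b else 0
    have hY : ∀ b, ‖Y b‖ ≤ a := fun b => by
      by_cases hb : blockOf b.src = c.tgt ∧ blockOf b.tgt = c.tgt
      · simp only [Y, if_pos hb, adJ]
        have hu1 : axialT U (emb c.tgt) b.src ∈ U1 (Matrix n n ℂ) := by
          rw [axialT_congr_of_block hj (fun b' h1 h2 => (hU'U b' (Or.inr h1) (Or.inr h2)).symm) hb.1]; exact axialT_mem_U1 hU'1 _ _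
        exact (norm_units_conj_le hu1 _).trans (hA b (Or.inr hb.1) (Or.inr hb.2))
      · simp only [Y, if_neg hb, norm_zero]; exact ha0
    have hmY : mt = combMean Y c.tgt := combMean_congr_block hj c.tgt fun b h1 h2 => by simp only [Y, if_pos (And.intro h1 h2)]
    rw [hmY]; exact norm_combMean_le_of_bound Y ha0 hY c.tgt
  have hY' : ‖(g : Matrix n n ℂ) * mt * ((g⁻¹ : (Matrix n n ℂ)ˣ) : Matrix n n ℂ)‖ ≤ ℓ * a := by
    have hg1 : g ∈ U1 (Matrix n n ℂ) := by rw [hg, hvv' _ (Or.inr (Site.blockOf_emb hj c.tgt))]; exact axialT_mem_U1 hU'1 _ _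
    exact (norm_units_conj_le hg1 _).trans hmt
  have hconjE : ‖(UA : Matrix n n ℂ) * mt * ((UA⁻¹ : (Matrix n n ℂ)ˣ) : Matrix n n ℂ) - (g : Matrix n n ℂ) * mt * ((g⁻¹ : (Matrix n n ℂ)ˣ) : Matrix n n ℂ)‖ ≤
      4 * (17 * ℓ * t) * (ℓ * a) := by
    have hid : (UA : Matrix n n ℂ) * mt * ((UA⁻¹ : (Matrix n n ℂ)ˣ) : Matrix n n ℂ) =
        (E : Matrix n n ℂ) * ((g : Matrix n n ℂ) * mt * ((g⁻¹ : (Matrix n n ℂ)ˣ) : Matrix n n ℂ)) * ((E⁻¹ : (Matrix n n ℂ)ˣ) : Matrix n n ℂ) := by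
      rw [hUA_eq, mul_inv_rev, Units.val_mul, Units.val_mul]; noncomm_ring
    rw [hid]
    exact (norm_conj_sub_le_of_near_one h17 (by nlinarith) _).trans (mul_le_mul_of_nonneg_left hY' (by positivity))
  have hbase : ‖((η / ξ : ℝ) : ℂ) • (((UA : Matrix n n ℂ) * mt * ((UA⁻¹ : (Matrix n n ℂ)ˣ) : Matrix n n ℂ) -
        (g : Matrix n n ℂ) * mt * ((g⁻¹ : (Matrix n n ℂ)ˣ) : Matrix n n ℂ)) - (lt - (g : Matrix n n ℂ) * mt * ((g⁻¹ : (Matrix n n ℂ)ˣ) : Matrix n n ℂ)))‖ ≤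
      η / ξ * (69 * ℓ ^ 2 * t * a) := by
    rw [norm_smul, Complex.norm_real, Real.norm_of_nonneg hηξ]
    refine mul_le_mul_of_nonneg_left ((norm_sub_le _ _).trans ?_) hηξ
    have h2' : ‖lt - (g : Matrix n n ℂ) * mt * ((g⁻¹ : (Matrix n n ℂ)ˣ) : Matrix n n ℂ)‖ ≤ ℓ ^ 2 * t * a := h2
    nlinarith [hconjE, h2', mul_nonneg (mul_nonneg hℓ0 ht0) ha0]
  refine (norm_add_le _ _).trans ?_
  have := add_le_add h1 hbase
  rw [hℓdef] at this
  linarith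

end C0Sum

end YMDAG.N18.TransportOfRecord

end
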